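import Literature.NumberTheory.GelbartRogawski1991.LocalSplittingUnitary
import Literature.NumberTheory.GelbartRogawski1991.LocalLeraySection
import Literature.NumberTheory.Automorphic.SmoothRepresentation
import Mathlib.GroupTheory.Index
import HarnessLib

/-!
# ANY splitting of `U(J)(F_v)` into `S̃p_{ψ_v}(𝕎_v)` acts CONFORMALLY on `𝒮(F_vᴺ)`, and isometrically on compact subgroups

Topic `NumberTheory/GelbartRogawski1991`; namespace
`Literature.NumberTheory.GelbartRogawski1991.UnitaryDualPair.LocalSplitting`.  KERNEL ONLY: theorems; no definition, no
named fact, no `sorry`.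

`LocalSplittingUnitary.lean` shows that the tree's OWN local splittings (Leray–Rao section, Kudla's `β`) give
`L²`-isometric Weil representations.  The named facts of `MoeglinVignerasWaldspurger1987/RankOneThetaLift.lean` quantify
over an ARBITRARY homomorphism `s : U(J)(F_v) →* S̃p_{ψ_v}(𝕎_v)` (over `ι_v`, with `ω_s = (MpPsi.toRep ρ_v) ∘ s` smooth);
such an `s` need not be unitary (twist a unitary one by a non-unitary character with open kernel, when one exists), but:

* **`exists_l2NormSq_toRep_comp_eq_mul`** (§1) — for EVERY homomorphism `s : G →* S̃p_{ψ_v}(𝕎_v)` from any group and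
  every `g`, the operator `ω_s(g)` is CONFORMAL for `‖·‖_{L²(μ'ᴺ)}`: `‖ω_s(g)Φ‖² = c_g ‖Φ‖²` for a constant
  `0 < c_g < ∞` (every `x ∈ Sp(𝕎_v)` has an `L²`-isometric implementer, tree `exists_isometric_implementer_localSchrodinger`
  [Weil1964, Chap. I n° 13], and implementers are unique up to a scalar, tree
  `implementerUniqueUpToScalar_localSchrodinger` [MoeglinVignerasWaldspurger1987, Chap. 2 II.1 (A)]);
* **`l2NormSq_toRep_comp_eq_of_mem_compact`** (§2) — if moreover `G` is a topological group and `ω_s` is SMOOTH, then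
  `ω_s(k)` is `L²`-ISOMETRIC for every `k` in a COMPACT subgroup `K ≤ G`: `k^n` fixes a non-zero Schwartz–Bruhat
  function for some `n ≥ 1` (the open stabiliser has finite index in `K`, Mathlib `Subgroup.exists_pow_mem_of_index_ne_zero`),
  so `c_k^n = 1` and `c_k = 1`.

Consequences used by the cell `hodgecm-mathlib` (KEY `b4-howe-compact-irreducible`, node D1 of the doubling proof of
`mvw_IV4_rankOne_irreducibleOrZero`): orthogonal complements (for the `L²` inner product) of `ω_s`-invariant subspaces of
`𝒮(F_vᴺ)` are `ω_s`-invariant (conformality suffices), and on a compact open `K ≤ U(J)(F_v)` the representation is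
honestly unitary, which is what `RepresentationTheory/Unitary/AdmissibleUnitarySemisimple.lean` consumes.  Nothing of the
cited sources is asserted.

## References
* [Weil1964] A. Weil, Acta Math. 111 (1964), Chap. I n° 13 (unitarity of the operators `t₀`, `d₀`, `d₀'`).
* [MoeglinVignerasWaldspurger1987] C. Mœglin, M.-F. Vignéras, J.-L. Waldspurger, LNM 1291 (1987), Chap. 2 II.1 (A)–(B).
-/

set_option autoImplicit false

noncomputable section

open NumberField IsDedekindDomain _root_.MeasureTheory Matrix
open scoped ENNReal
open Literature.RepresentationTheory.HeisenbergGroup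
open Literature.NumberTheory.Automorphic Literature.NumberTheory.Weil1964

namespace Literature.NumberTheory.GelbartRogawski1991.UnitaryDualPair.LocalSplitting

variable {F : Type} [Field F] [NumberField F] {N : ℕ} {T : Matrix (Fin N) (Fin N) F} {hTd : IsUnit T.det}
  {v : HeightOneSpectrum (𝓞 F)}
  [MeasurableSpace (v.adicCompletion F)] [BorelSpace (v.adicCompletion F)]
  (μ' : Measure (v.adicCompletion F)) [μ'.IsAddHaarMeasure]
  {G : Type*} [Group G] (s : G →* LocalMp F N T v)

/-! ## §1 Every splitting acts conformally -/

include hTd in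
/-- **`‖ω_s(g)Φ‖²_{L²} = c_g ‖Φ‖²_{L²}` with `0 < c_g < ∞`**, for ANY homomorphism `s : G →* S̃p_{ψ_v}(𝕎_v)` and any
`g` (the operator `ω_s(g)` is a scalar multiple of an `L²`-isometric implementer of the same symplectic element).
[cite: MoeglinVignerasWaldspurger1987, Chap. 2 II.1 (A)] -/
theorem exists_l2NormSq_toRep_comp_eq_mul (g : G) :
    ∃ c : ℝ≥0∞, c ≠ 0 ∧ c ≠ ∞ ∧ ∀ Φ : SchwartzBruhat (Fin N → v.adicCompletion F),
      SchwartzBruhat.l2NormSq (Measure.pi fun _ : Fin N => μ') (((MpPsi.toRep (localSchrodinger F N T v)).comp s) g Φ) =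
        c * SchwartzBruhat.l2NormSq (Measure.pi fun _ : Fin N => μ') Φ := by
  -- an isometric implementer `M₀` of the symplectic element under `s g`
  obtain ⟨M₀, hM₀, hiso⟩ := exists_isometric_implementer_localSchrodinger (hTd := hTd) μ'
    (MpPsi.proj (localSchrodinger F N T v) (s g))
  -- the operator of `s g` implements the same element, hence is `a • M₀`
  have hM := MpPsi.toRep_implements (localSchrodinger F N T v) (s g)
  obtain ⟨a, ha⟩ := implementerUniqueUpToScalar_localSchrodinger F N T hTd v _ M₀ _ hM₀ hM
  refine ⟨‖(a : ℂ)‖ₑ ^ 2, ?_, ?_, fun Φ => ?_⟩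
  · exact pow_ne_zero _ (by rw [ne_eq, enorm_eq_zero]; exact a.ne_zero)
  · exact ENNReal.pow_ne_top enorm_ne_top
  · have h1 : ((MpPsi.toRep (localSchrodinger F N T v)).comp s) g Φ = (a : ℂ) • M₀ Φ := by
      rw [MonoidHom.comp_apply, MpPsi.toRep_apply]
      exact ha Φ
    rw [h1, SchwartzBruhat.l2NormSq_smul, hiso Φ]

/-! ## §2 Smooth splittings are isometric on compact subgroups -/

include hTd in
/-- **`ω_s(k)` is `L²`-isometric for `k` in a compact subgroup**, when `ω_s` is smooth: some power `k^n`, `n ≥ 1`,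
fixes a non-zero Schwartz–Bruhat function (the open stabiliser meets `K` in a subgroup of finite index), so the
conformal factor satisfies `c_k^n = 1`. [cite: Weil1964, Chap. I n° 13] -/
theorem l2NormSq_toRep_comp_eq_of_mem_compact [TopologicalSpace G] [IsTopologicalGroup G]
    (hsm : Representation.IsSmooth ((MpPsi.toRep (localSchrodinger F N T v)).comp s))
    (K : Subgroup G) (hK : IsCompact (K : Set G)) {k : G} (hk : k ∈ K)
    (Φ : SchwartzBruhat (Fin N → v.adicCompletion F)) :
    SchwartzBruhat.l2NormSq (Measure.pi fun _ : Fin N => μ') (((MpPsi.toRep (localSchrodinger F N T v)).comp s) k Φ) =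
      SchwartzBruhat.l2NormSq (Measure.pi fun _ : Fin N => μ') Φ := by
  haveI := secondCountableTopology_adicCompletion F v
  set ω : Representation ℂ G (SchwartzBruhat (Fin N → v.adicCompletion F)) :=
    (MpPsi.toRep (localSchrodinger F N T v)).comp s with hω
  obtain ⟨c, hc0, hctop, hc⟩ := exists_l2NormSq_toRep_comp_eq_mul (hTd := hTd) μ' s k
  -- a non-zero test function and its open stabiliser
  haveI : Nontrivial (SchwartzBruhat (Fin N → v.adicCompletion F)) := nontrivial_schwartzBruhat_pi
  obtain ⟨Φ₀, hΦ₀⟩ := exists_ne (0 : SchwartzBruhat (Fin N → v.adicCompletion F))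
  have hpos : SchwartzBruhat.l2NormSq (Measure.pi fun _ : Fin N => μ') Φ₀ ≠ 0 :=
    (SchwartzBruhat.l2NormSq_pos _ hΦ₀).ne'
  have htop : SchwartzBruhat.l2NormSq (Measure.pi fun _ : Fin N => μ') Φ₀ ≠ ∞ :=
    SchwartzBruhat.l2NormSq_ne_top _ Φ₀
  -- inside the compact group `K`, the stabiliser has finite index: `k^n` fixes `Φ₀`
  haveI : CompactSpace K := isCompact_iff_compactSpace.mp hK
  set H : Subgroup K := (Representation.stabilizerSubgroup ω Φ₀).comap K.subtype with hH
  have hHo : IsOpen (H : Set K) := (hsm Φ₀).preimage continuous_subtype_val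
  haveI : Finite (K ⧸ H) := Subgroup.quotient_finite_of_isOpen H hHo
  obtain ⟨n, hn, -, hkn⟩ := Subgroup.exists_pow_mem_of_index_ne_zero (Subgroup.index_ne_zero_of_finite (H := H))
    (⟨k, hk⟩ : K)
  have hfix : ω (k ^ n) Φ₀ = Φ₀ := by
    have := (Representation.mem_stabilizerSubgroup ω Φ₀ _).1 (Subgroup.mem_comap.1 hkn)
    simpa only [Subgroup.coe_subtype, SubgroupClass.coe_pow] using this
  -- `‖ω(k)^j Φ‖² = c^j ‖Φ‖²`
  have hpow : ∀ (j : ℕ) (Φ : SchwartzBruhat (Fin N → v.adicCompletion F)),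
      SchwartzBruhat.l2NormSq (Measure.pi fun _ : Fin N => μ') (ω (k ^ j) Φ) =
        c ^ j * SchwartzBruhat.l2NormSq (Measure.pi fun _ : Fin N => μ') Φ := by
    intro j
    induction j with
    | zero => intro Φ; rw [pow_zero, map_one, pow_zero, one_mul]; rfl
    | succ j ih =>
        intro Φ
        rw [pow_succ, map_mul, Module.End.mul_apply, ih, hc Φ, ← mul_assoc, ← pow_succ]
  -- hence `c^n = 1`, so `c = 1`
  have hcn : c ^ n = 1 := by
    have h := hpow n Φ₀
    rw [hfix] at h
    -- `x = c^n * x` with `x ≠ 0, ∞`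
    have h' : c ^ n * SchwartzBruhat.l2NormSq (Measure.pi fun _ : Fin N => μ') Φ₀ =
        1 * SchwartzBruhat.l2NormSq (Measure.pi fun _ : Fin N => μ') Φ₀ := by rw [one_mul]; exact h.symm
    exact (ENNReal.mul_left_inj hpos htop).1 h'
  have hc1 : c = 1 := by
    rcases lt_trichotomy c 1 with hlt | heq | hgt
    · exact absurd hcn (pow_lt_one₀ (bot_le : (0 : ℝ≥0∞) ≤ c) hlt (n := n) hn.ne').ne
    · exact heq
    · exact absurd hcn (one_lt_pow₀ hgt hn.ne').ne'
  rw [hc Φ, hc1, one_mul]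

end Literature.NumberTheory.GelbartRogawski1991.UnitaryDualPair.LocalSplitting

end
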